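import Literature.MathematicalPhysics.QuantumFieldTheory.Balaban1983to89.B11Eq44COperatorTorus
import Literature.MathematicalPhysics.QuantumFieldTheory.Balaban1983to89.B9Eq315QTower
import Literature.MathematicalPhysics.QuantumFieldTheory.Balaban1983to89.B7Prop4GeneralCk

/-!
# `Balaban1983to89.B11Eq44COperatorTower` — T. Bałaban, *The variational problem and background fields in renormalization group method for
lattice gauge theories*, Commun. Math. Phys. **102** (1985) 277–309 [Balaban1985Variational], Sect. C p. 285 (44), with [Balaban1985Averaging]
(= [4]) Proposition 2 (52)–(54) p. 26, (127) p. 37, Proposition 4 (130)–(135) pp. 38–39: **THE REMAINDER `C_k` OF (44) AT `k` AVERAGING LEVELS ON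
THE TOWER OF TORI `T_{L^k m} → ⋯ → T_m` — (44) VERBATIM AGAINST THE OWNER's COMPOSITE `Q_k(U)`, ITS BOUND (135) AND ANALYTICITY AT A UNIT BOND,
and the per-level background data of `B9Eq315QTower` DISCHARGED from [4] Proposition 2's (52)** — all from the NE7c ∕ lit-balaban crews' [4] theorems;
file 1 of the `k`-level twin of `B11Eq44COperatorTorus` (file 2 = `B11Eq44CLetterTower`: the letter between the carriers of (115) and its `Regime` slot)

statement-level skeleton of published theorems with citation tags; proofs where landed; nothing here is a claim about the Yang–Mills mass gap

PDF held: `paper:balaban1985-cmp102-variational-background` (journal page = PDF page + 276); p. 285 as quoted in `B11Eq44COperatorTorus` (render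
`pub-balaban/b2b-balaban-ref1/pages/1985-cmp102-variational-background/1985-cmp102-variational-background-p009-x2.png`); [4] =
`paper:balaban1985-cmp98-averaging` pp. 25–26, 37–39 through the verbatim quotations of `B7Prop2Explicit` ∕ `B7Prop4GeneralLevels` ∕ `B7Eq123General`.

THE PRINT (verbatim, p. 285): *«The Proposition 4 of [4] implies Q_j(ηA) = LʲηQ_jA + C_j(LʲηA), |C_j(LʲηA)| ≦ C₂(Lʲη)²|A|². (44) … Thus the
function D(A′) is a fixed point of the transformation X → C_j(LʲηA′ − LʲηHX) on Λ_j, j = 0, 1, …, k. (50)»*.  [4] p. 38: *«Q_k(U₀, ηA) = Q_k(U₀)A +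
C_k(U₀, A), (134) and |C_k(U₀, A)| ≦ C₂|A|² < C₂α₁². (135)»*, (133): *«… < e^{O(1)2α₀}8C₁α₁² = C₂α₁²»*, p. 39: *«The constants C₂, c₄ are independent
of k, C₂ depends on d and c₄ depends on d and L.»*; p. 37 (after (127)): *«We assume that U₀ satisfies the assumptions of Proposition 2 and U₁ = e^{iηA},
|A| < α₁. Then by this proposition the configurations Ū₀ʲ for j < k satisfy the assumptions of Proposition 3 for V₀ = Ū₀ʲ if α₀L^{2j}η² +
2C₀(α₀L^{2j}η²)² ≦ 2α₀L^{2j}η² < α₀ ≦ c₃.»*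

WHY THIS FILE (cell context).  `B11Eq44COperatorTorus` (INTERFACE REQUEST NE9 letter (L5)) typed `C` at ONE averaging level (its reading (M3)) against
the owner's one-step torus `Q(U)` (E162); the owner has since typed the COMPOSITE `Q_k(U) = Q(Ū^{k−1})⋯Q(U)` of [5] (3.15) on the tower of tori
(`B9Eq315QTower`) and (3.26) at `n+1` levels (`B9Eq326OperatorTower`), lifting (M3) for 𝔊 ∕ H₁.  This pair of files lifts (M3) for `C`.  THIS FILE:
print's `C_k(LᵏηA)` of (44) at `j = k` at a unit bond, typed against `QkOfU`, its two analytic clauses DISCHARGED from the crews' theorems at a general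
regular background; and the per-level background data DISPLAYED by `B9Eq315QTower` (its (M2): `hU1 n`, `hreg n` of `UlevOf`, «NOT proved here»)
DISCHARGED from [4] Proposition 2's printed hypothesis (52) on the ONE background `U`, for EVERY level — p. 37's sentence above, which the crews PROVED
(`B7Prop4GeneralLevels.level_regularity` from b07's kernel Proposition 2).

DICTIONARY ∕ MODEL READINGS ((M1), (M3) of `B9Eq315QTower`; (M4), (M5) of `B11Eq44COperatorTorus`: `B := η•A` carries the `η`, fibre `𝔸` complete
normed with `‖1‖ = 1`).  (M1) tower `towerP L m n = L^n·m`; finest torus `T_{L^k m}` (bonds `Bond d (towerP L m k)` = print's Ω_k-bonds), unit torus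
`T_m` (bonds `Bond d m` = 𝔅 at the top level); periodic extension `perCfg` to `ℤ^d`; the unit bond `(y, κ)` is read at the representative
`(liftSite y, κ)`.  (M2-k) [4] PROPOSITION 2's DATA on `Ũ = perCfg U`: values in an averaging-closed group `G ⊂ {|u| ≤ 1, |u⁻¹| ≤ 1}` (`AvgClosed`; the
unitary group qualifies), (52) `pdev Ũ < α₀·L^{−2k}` («|U(∂p) − 1| < α₀η²», `η = L^{−k}`), `C₀α₀ ≤ 1/3`, `4α₀ ≤ c₂′(d,L)` — INSTEAD OF the per-level
displays of `B9Eq315QTower`, which §2 DERIVES.  CONSTANTS: `C₂ = 8C₁e^{4cα₀}`, `C₁ = 131072(d+1)²`, `c = 800(d+1)²(d+4)` — print's «e^{O(1)2α₀}8C₁ = C₂»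
(`C2T`, `k`-free); the radius enters through [4] Prop. 4's two smallness conditions (`e^{4cα₀}(1 + 8C₁Lᵏa) ≤ 2`, `2Lᵏa ≤ c₃(d,L)`), displayed.

WHAT IS DEFINED AND PROVED (sorry-free; no `Prop` placeholder; no inequality of the paper asserted — (52)⇒(54), (130)–(135) and Prop. 4's
analyticity are the crews' THEOREMS `level_regularity` ∕ `level_data`, `blockLoops_of_pdev`, `prop4_general`, `prop4_general_analyticAt`, instantiated).
* §0 `C2T d α₀`, `αT d L α₀ = 32(d+1)(d+4)L²α₀`, `αT_le` (`4α₀ ≤ c₂′ ⇒ αT ≤ 1/64`, E162's block-loop threshold).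
* §1 **`Cblockk L m η k U A c`** := `logCovIter − linCovIter` of the extensions of `U`, `η•A` at level `k`, bond `(liftSite y, κ)` — print's `C_k(LᵏηA)(c)`
  (= NE7c's `B7Prop5GeneralInduction.CCovIter` (150), spelled out to keep the imports small); `Cblockk_zero`.
* §2 **(M2) OF `B9Eq315QTower` DISCHARGED FROM (52)**: `ulev_mem_U1_of_pdev`, `ulev_reg_of_pdev` (regularity `αT` at EVERY level `n`: `n + 1 ≤ k` by the
  owner's `perCfg_UlevOf`, the junk levels `k ≤ n + 1` being the background itself, `perCfg_UlevOf_of_le`); the canonical composite **`QkOfPdev`** :=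
  `QkOfU` at these data, `QkOfPdev_surjective` (regime `50(d+1)·αT·L^d ≤ 1/2`).
* §3 **`eq44k`** — (44) VERBATIM at `j = k` against `QkOfU` for ANY admissible per-level data: `Q_k(Ũ, ηÃ)(c̃) = (Lᵏη)·(Q_k(U)A)(c) + Cblockk A c` (the
  owner's `QkOfU_apply_eq_linCovIter` + linearity: `linCovIter_perCfg_smul_k`).
* §4 **`norm_Cblockk_le`** — (135) at a unit bond: `η·sup‖A‖ ≤ a` + smallness at `Lᵏa` ⇒ `‖Cblockk A c‖ ≤ C₂·(Lᵏa)²`; **`analyticAt_Cblockk`** — Prop. 4's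
  clause, Fréchet in `A` on the finite-dimensional torus configuration space (`prop4_general_analyticAt` in family form; the linear part by §3 at `QkOfPdev`).
HONEST SCOPE.  Assembly + instantiation; the estimates are the crews'.  NOT typed here (named): the multi-level reading `lev₀ = levOf Ω k` with `C_j` on
each `Λ_j` (large-field steps), complex backgrounds ([4] Prop. 7, `B7Prop7Ck`).  NOT summit progress (cell pub-balaban: NE9 NOT PRINTED ∕ NOT PROVED,
«NE9 ⇐ the named binders»; spine PROVED 0/9; rung (B)+1 on a finite T⁴ — NOT infinite volume, NOT mass gap, NOT Clay).  Filed by the NE9 crux-team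
leaf seat `b2b-balaban-t4-ne9-formalise-leaf-03` (gen 55); NEW file; imports `B11Eq44COperatorTorus`, `B9Eq315QTower`, `B7Prop4GeneralCk`; nothing
modified.  Net new unproved facts: 0.
-/

noncomputable section

namespace Literature.MathematicalPhysics.QuantumFieldTheory.Balaban1983to89.B11Eq44COperatorTower

open Metric Set
open B9Eq315QTorus (perSite perCfg perCfg_apply cornerSite)
open B9Eq315QTorusOnto (liftSite)
open B9Eq315QTower (towerP towerP_apply UlevOf QkOfU QkOfU_surjective QkOfU_apply_eq_linCovIter perCfg_UlevOf)
open B9SectCLatticeCarrier (Bond)   open B4Sect5Torus (TSite)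
open B7Prop1Explicit (U1 Wcx boxVec)
open B7Prop2Explicit (pdev AvgClosed C0 c2' avgIter avgIter_zero)
open B7Prop3Flat (c3)
open B7Prop3GeneralLinear (linQcov Qcov_zero)
open B7Prop4GeneralLevels (logCovIter linCovIter linCovIter_succ level_regularity)
open B7Eq123General (prop4_general blockLoops_of_pdev level_data)
open B7Prop6GeneralAnalytic (prop4_general_analyticAt)
open B7Prop4GeneralCk (logCovIter_zero_field)

variable {d : ℕ} {𝔸 : Type*} [NormedRing 𝔸] [NormedAlgebra ℂ 𝔸] [CompleteSpace 𝔸] (L : ℕ) [NeZero L] (m : Fin d → ℕ) [∀ i, NeZero (m i)]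
  (η : ℝ) (k : ℕ) (U : Bond d (towerP L m k) → 𝔸ˣ)

/-! ## §0 The constants: print's `C₂ = e^{O(1)2α₀}·8C₁` of (133) and the uniform level regularity `αT` -/

/-- **Print's `C₂ = e^{O(1)2α₀}·8C₁`** of [4] (133)∕(135) with the crews' explicit `O(1)` (`B7Eq123General.prop4_general`): `8·C₁·e^{4cα₀}` —
«independent of k, C₂ depends on d» (and on the displayed `α₀`). [cite: Balaban1985Averaging, (133) p.38, (135) p.38; Balaban1985Variational, (44) p.285] -/
def C2T (d : ℕ) (α₀ : ℝ) : ℝ := 8 * (131072 * ((d : ℝ) + 1) ^ 2) * Real.exp (4 * (800 * ((d : ℝ) + 1) ^ 2 * ((d : ℝ) + 4)) * α₀)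

/-- `C₂ ≥ 0`. [cite: Balaban1985Averaging, (133) p.38] -/
theorem C2T_nonneg (d : ℕ) (α₀ : ℝ) : 0 ≤ C2T d α₀ := by unfold C2T; positivity

/-- **The uniform block-loop regularity of ALL the level backgrounds `Ū^j`** («2α₀L^{2j}η²» of p. 37 in the `O(1)L²α₀` currency of p. 25):
`32(d+1)(d+4)L²α₀`. [cite: Balaban1985Averaging, p.37 (after (127)), p.25 (displays before (47))] -/
def αT (d L : ℕ) (α₀ : ℝ) : ℝ := 32 * ((d : ℝ) + 1) * ((d : ℝ) + 4) * (L : ℝ) ^ 2 * α₀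

/-- `4α₀ ≤ c₂′(d,L) = 1/(512(d+1)(d+4)L²)` gives `αT ≤ 1/64` — the block-loop threshold of E162's `QtorusLin`. [cite: Balaban1985Averaging, (52) p.26, p.25] -/
theorem αT_le {L : ℕ} (hL : 1 ≤ L) {α₀ : ℝ} (hα4 : 4 * α₀ ≤ c2' d L) : αT d L α₀ ≤ 1 / 64 := by
  have hX : (0 : ℝ) < 512 * ((d : ℝ) + 1) * ((d : ℝ) + 4) * (L : ℝ) ^ 2 := by
    have : (0 : ℝ) < L := by exact_mod_cast hL
    positivity
  have h1 : 4 * α₀ * (512 * ((d : ℝ) + 1) * ((d : ℝ) + 4) * (L : ℝ) ^ 2) ≤ 1 := by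
    have := mul_le_mul_of_nonneg_right hα4 hX.le
    rwa [c2', one_div, inv_mul_cancel₀ hX.ne'] at this
  unfold αT
  nlinarith

/-! ## §1 The composite remainder `C_k(Lᵏη ·)` at a unit bond -/

/-- **Print's `C_k(LᵏηA)` at the unit bond `c = (y, κ)` of `T_m`** — [4] (134)'s remainder `Q_k(Ũ, ηÃ) − LᵏηQ_k(Ũ)Ã` (the crews' `logCovIter − linCovIter`;
= NE7c's `CCovIter` (150)) of the periodic extensions at the representative `(liftSite y, κ)` (readings (M1), (M4)).
[cite: Balaban1985Variational, (44) p.285, (50) p.285; Balaban1985Averaging, (134) p.38, (127) p.37] -/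
def Cblockk (A : Bond d (towerP L m k) → 𝔸) (c : Bond d m) : 𝔸 :=
  logCovIter L (perCfg (towerP L m k) U) (perCfg (towerP L m k) ((η : ℂ) • A)) k (liftSite c.1) c.2 -
    linCovIter L (perCfg (towerP L m k) U) (perCfg (towerP L m k) ((η : ℂ) • A)) k (liftSite c.1) c.2

/-- Unfolding. [cite: Balaban1985Variational, (44) p.285] -/
theorem Cblockk_apply (A : Bond d (towerP L m k) → 𝔸) (c : Bond d m) :
    Cblockk L m η k U A c = logCovIter L (perCfg (towerP L m k) U) (perCfg (towerP L m k) ((η : ℂ) • A)) k (liftSite c.1) c.2 -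
      linCovIter L (perCfg (towerP L m k) U) (perCfg (towerP L m k) ((η : ℂ) • A)) k (liftSite c.1) c.2 := rfl

omit [NeZero L] [∀ i, NeZero (m i)] in
/-- The composed linear part of the zero field vanishes: `LʲηQ_j(V)0 = 0` (each factor (122) is the derivative of a constant). [cite: Balaban1985Averaging, (127) p.37, (122) p.36] -/
theorem linCovIter_zero_field (V : B7Prop1Explicit.Site d → Fin d → 𝔸ˣ) : ∀ j : ℕ, linCovIter L V (0 : B7Prop1Explicit.Site d → Fin d → 𝔸) j = 0
  | 0 => rfl
  | j + 1 => by
    funext z κ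
    rw [linCovIter_succ, linCovIter_zero_field V j, Pi.zero_apply, Pi.zero_apply]
    simp only [linQcov, smul_zero, Qcov_zero, deriv_const]

/-- `C_k` has no constant term: `Cblockk 0 = 0`. [cite: Balaban1985Variational, (55) p.286; Balaban1985Averaging, (134)–(136) pp.38–39] -/
theorem Cblockk_zero : Cblockk L m η k U 0 = 0 := by
  funext c
  have h0 : perCfg (towerP L m k) ((η : ℂ) • (0 : Bond d (towerP L m k) → 𝔸)) = 0 := by rw [smul_zero]; rfl
  rw [Cblockk_apply, Pi.zero_apply, h0, logCovIter_zero_field, linCovIter_zero_field, Pi.zero_apply, Pi.zero_apply, sub_zero]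

/-! ## §2 (M2) of `B9Eq315QTower` DISCHARGED from [4] Proposition 2's (52) on the one background `U` -/

section Levels

variable [NormOneClass 𝔸] (hL : 2 ≤ L) {G : Subgroup 𝔸ˣ} (hG : AvgClosed d L G)
  (hU : ∀ (x : B7Prop1Explicit.Site d) (κ : Fin d), perCfg (towerP L m k) U x κ ∈ G) {α₀ : ℝ} (hα : 0 < α₀)
  (hα3 : C0 d * α₀ ≤ 1 / 3) (hα4 : 4 * α₀ ≤ c2' d L) (h52 : pdev (perCfg (towerP L m k) U) < α₀ * (((L : ℝ) ^ k)⁻¹) ^ 2)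

omit [NormOneClass 𝔸] in
/-- Reading a site of `ℤ^d` on a coarser torus of the tower factors through any finer one (`L^k m ∣ L^n m` for `k ≤ n`: `(x mod P_n) mod P_k = x mod P_k`).
[cite: Balaban1985Averaging, (1)–(2) p.17] -/
theorem perSite_liftSite_perSite {k n : ℕ} (hkn : k ≤ n) (x : B7Prop1Explicit.Site d) :
    perSite (towerP L m k) (liftSite (perSite (towerP L m n) x)) = perSite (towerP L m k) x := by
  funext i
  apply Fin.ext
  have hP : (0 : ℤ) < (towerP L m n i : ℤ) := by exact_mod_cast Nat.pos_of_ne_zero (NeZero.ne (towerP L m n i))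
  have hdvd : (towerP L m k i : ℤ) ∣ (towerP L m n i : ℤ) := by
    rw [towerP_apply, towerP_apply]; exact_mod_cast mul_dvd_mul_right (pow_dvd_pow L hkn) (m i)
  simp only [perSite, liftSite, Int.toNat_of_nonneg (Int.emod_nonneg _ hP.ne'), Int.emod_emod_of_dvd _ hdvd]

omit [NormOneClass 𝔸] in
/-- **The junk levels `k ≤ n + 1` of `UlevOf` are the background itself**: there `UlevOf L m k U n = Ū⁰ = Ũ` read on the (finer-period) level torus, so
its periodic extension IS `Ũ` (complements the owner's `perCfg_UlevOf`, levels `n + 1 ≤ k`). [cite: Balaban1985Averaging, (43) p.24, (1)–(2) p.17] -/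
theorem perCfg_UlevOf_of_le {n : ℕ} (hn : k ≤ n + 1) : perCfg (towerP L m (n + 1)) (UlevOf L m k U n) = perCfg (towerP L m k) U := by
  funext x κ
  simp only [perCfg_apply, UlevOf, show k - 1 - n = 0 by omega, avgIter_zero, perSite_liftSite_perSite L m hn]

omit [NormOneClass 𝔸] in
/-- **EVERY level background of the tower is an averaged background `Ū^j`, `j ≤ k`**: `perCfg (UlevOf L m k U n) = Ū^j`, `j = k − 1 − n` (or `0`) — so
[4] Prop. 2 per level (`B7Eq123General.level_data`) applies to each. [cite: Balaban1985Averaging, (43) p.24, p.37 (after (127))] -/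
theorem ulev_eq_avgIter (n : ℕ) : ∃ j ≤ k, perCfg (towerP L m (n + 1)) (UlevOf L m k U n) = avgIter L (perCfg (towerP L m k) U) j := by
  by_cases hn : n + 1 ≤ k
  · exact ⟨k - 1 - n, by omega, perCfg_UlevOf L m hn U⟩
  · exact ⟨0, Nat.zero_le _, by rw [perCfg_UlevOf_of_le L m k U (by omega), avgIter_zero]⟩

include hL hG hU hα hα3 hα4 h52 in
/-- **(M2) of `B9Eq315QTower`, FIRST HALF, DISCHARGED**: every level background `UlevOf L m k U n`, extended to `ℤ^d`, takes values in `{|u| ≤ 1, |u⁻¹| ≤ 1}`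
— [4] Prop. 2: `Ū^j` is `G`-valued, `G ⊂ U1`. [cite: Balaban1985Averaging, Proposition 2 p.26, (22)–(23) p.20] -/
theorem ulev_mem_U1_of_pdev (n : ℕ) (x : B7Prop1Explicit.Site d) (κ : Fin d) : perCfg (towerP L m (n + 1)) (UlevOf L m k U n) x κ ∈ U1 𝔸 := by
  obtain ⟨j, hj, hper⟩ := ulev_eq_avgIter L m k U n
  rw [hper]
  exact hG.le_U1 ((level_regularity L hL hG k _ hU hα hα3 (by linarith) h52 j hj).2 x κ)

include hL hG hU hα hα3 hα4 h52 in
/-- **(M2) of `B9Eq315QTower`, SECOND HALF, DISCHARGED**: the block loops of every level background are within `αT = 32(d+1)(d+4)L²α₀` of `1` at every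
block — p. 25 «|V₀(Γ_{c,x}) − 1| < … = O(1)L²α₀» at the level regularity `2α₀(Lʲ/Lᵏ)² ≤ 2α₀` (`blockLoops_of_pdev` = Prop. 1 in plaquette currency).
[cite: Balaban1985Averaging, p.25 (displays before (47)), Proposition 2 (54) p.26, p.37] -/
theorem ulev_reg_of_pdev (n : ℕ) (y : TSite d (towerP L m n)) (κ : Fin d) (r : Fin d → Fin L) :
    ‖((Wcx L (perCfg (towerP L m (n + 1)) (UlevOf L m k U n)) (cornerSite L y) κ (boxVec L r) : 𝔸ˣ) : 𝔸) - 1‖ ≤ αT d L α₀ := by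
  obtain ⟨j, hj, hper⟩ := ulev_eq_avgIter L m k U n
  have hL1 : 1 ≤ L := le_trans (by norm_num) hL
  have hL1' : (1 : ℝ) ≤ L := by exact_mod_cast hL1
  obtain ⟨hV1, hβ0, hβ, hβmax⟩ := level_data L hL hG k _ hU hα hα3 hα4 h52 j hj
  rw [hper]
  refine ((blockLoops_of_pdev hL1 hV1 hβ0 hβ hβmax (cornerSite L y) κ).1 r).trans ?_
  -- `16(d+1)(d+4)L²·2α₀(Lʲ/Lᵏ)² ≤ 32(d+1)(d+4)L²α₀` since `(Lʲ/Lᵏ)² ≤ 1`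
  have hLk : (0 : ℝ) < (L : ℝ) ^ k := by positivity
  have hratio : (L : ℝ) ^ j * ((L : ℝ) ^ k)⁻¹ ≤ 1 := by rw [mul_inv_le_iff₀ hLk, one_mul]; exact pow_le_pow_right₀ hL1' hj
  have hsq : ((L : ℝ) ^ j * ((L : ℝ) ^ k)⁻¹) ^ 2 ≤ 1 := by
    rw [← one_pow 2]; exact pow_le_pow_left₀ (by positivity) hratio 2
  have hpre : 0 ≤ 16 * ((d : ℝ) + 1) * ((d : ℝ) + 4) * (L : ℝ) ^ 2 * (2 * α₀) := by positivity
  unfold αT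
  nlinarith [mul_le_mul_of_nonneg_left hsq hpre]

/-- **THE COMPOSITE `Q_k(U)` OF [5] (3.15) AT THE DATA OF [4] PROPOSITION 2** — the owner's `QkOfU` with its per-level displays SUPPLIED by
`ulev_mem_U1_of_pdev` ∕ `ulev_reg_of_pdev` (regularity `αT` at every level, `αT ≤ 1/64`): the ONLY background hypotheses left are (52) and the group
data on `U`. [cite: Balaban1985BackgroundPropagators, (3.15) p.393; Balaban1985Averaging, Proposition 2 (52) p.26] -/
abbrev QkOfPdev : (Bond d (towerP L m k) → 𝔸) →ₗ[ℂ] (Bond d m → 𝔸) :=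
  QkOfU L m (le_trans (by norm_num) hL) k U (fun _ => αT d L α₀) (fun _ => αT_le (le_trans (by norm_num) hL) hα4)
    (ulev_mem_U1_of_pdev L m k U hL hG hU hα hα3 hα4 h52) (ulev_reg_of_pdev L m k U hL hG hU hα hα3 hα4 h52)

/-- **`Q_k(U)` at the Prop. 2 data is ONTO** in the regime `50(d+1)·αT·L^d ≤ 1/2` (the owner's `QkOfU_surjective`, every level at regularity `αT`).
[cite: Balaban1985BackgroundPropagators, (3.15) p.393, (3.126) p.420] -/
theorem QkOfPdev_surjective (hαL : 50 * (d + 1) * αT d L α₀ * (L : ℝ) ^ d ≤ 1 / 2) :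
    Function.Surjective (QkOfPdev L m k U hL hG hU hα hα3 hα4 h52) :=
  QkOfU_surjective L m _ k U _ _ _ _ fun _ => hαL

end Levels

/-! ## §3 (44) at `j = k` against the owner's composite `Q_k(U)` -/

section Linear

variable [NormOneClass 𝔸] (hL : 1 ≤ L) (α : ℕ → ℝ) (hα1 : ∀ n, α n ≤ 1 / 64)
  (hU1 : ∀ (n : ℕ) (x : B7Prop1Explicit.Site d) (κ : Fin d), perCfg (towerP L m (n + 1)) (UlevOf L m k U n) x κ ∈ U1 𝔸)
  (hreg : ∀ (n : ℕ) (y : TSite d (towerP L m n)) (κ : Fin d) (r : Fin d → Fin L),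
    ‖((Wcx L (perCfg (towerP L m (n + 1)) (UlevOf L m k U n)) (cornerSite L y) κ (boxVec L r) : 𝔸ˣ) : 𝔸) - 1‖ ≤ α n)

include hα1 hU1 hreg in
/-- **The composed linear part of the extension of `η•A` is `(Lᵏ·η) •` the owner's normalised `Q_k(U)A`** at every unit bond (`QkOfU_apply_eq_linCovIter`
+ linearity of `QkOfU`) — print's «LʲηQ_jA» at `j = k`. [cite: Balaban1985Variational, (44) p.285; Balaban1985Averaging, (127) p.37; Balaban1985BackgroundPropagators, (3.15) p.393] -/
theorem linCovIter_perCfg_smul_k (A : Bond d (towerP L m k) → 𝔸) (c : Bond d m) :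
    linCovIter L (perCfg (towerP L m k) U) (perCfg (towerP L m k) ((η : ℂ) • A)) k (liftSite c.1) c.2 =
      (((L : ℂ) ^ k) * η) • QkOfU L m hL k U α hα1 hU1 hreg A c := by
  have hLk : ((L : ℂ) ^ k) ≠ 0 := pow_ne_zero _ (by exact_mod_cast (NeZero.ne L))
  have h := QkOfU_apply_eq_linCovIter L m hL k U α hα1 hU1 hreg ((η : ℂ) • A) c
  rw [map_smul, Pi.smul_apply] at h
  rw [mul_smul, h, smul_smul, mul_inv_cancel₀ hLk, one_smul]

include hα1 hU1 hreg in
/-- **(44) VERBATIM at `j = k`, against the owner's composite on the tower**: «Q_k(ηA) = LᵏηQ_kA + C_k(LᵏηA)» — the `k`-step average `Q_k(Ũ, ηÃ)(c̃)` of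
[4] (127)∕(134) at the unit bond IS `(Lᵏη)·(Q_k(U)A)(c) + Cblockk A c`, for ANY admissible per-level data of `QkOfU`.
[cite: Balaban1985Variational, (44) p.285; Balaban1985Averaging, (134) p.38; Balaban1985BackgroundPropagators, (3.15) p.393] -/
theorem eq44k (A : Bond d (towerP L m k) → 𝔸) (c : Bond d m) :
    logCovIter L (perCfg (towerP L m k) U) (perCfg (towerP L m k) ((η : ℂ) • A)) k (liftSite c.1) c.2 =
      (((L : ℂ) ^ k) * η) • QkOfU L m hL k U α hα1 hU1 hreg A c + Cblockk L m η k U A c := by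
  rw [Cblockk_apply, linCovIter_perCfg_smul_k L m η k U hL α hα1 hU1 hreg, add_sub_cancel]

end Linear

/-! ## §4 The crews' (135) and Prop. 4 analyticity at a unit bond -/

section Pointwise

variable [NormOneClass 𝔸] (hL : 2 ≤ L) {G : Subgroup 𝔸ˣ} (hG : AvgClosed d L G)
  (hU : ∀ (x : B7Prop1Explicit.Site d) (κ : Fin d), perCfg (towerP L m k) U x κ ∈ G) {α₀ : ℝ} (hα : 0 < α₀)
  (hα3 : C0 d * α₀ ≤ 1 / 3) (hα4 : 4 * α₀ ≤ c2' d L) (h52 : pdev (perCfg (towerP L m k) U) < α₀ * (((L : ℝ) ^ k)⁻¹) ^ 2) (hη : 0 ≤ η)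

include hη in
omit [CompleteSpace 𝔸] [NormOneClass 𝔸] in
/-- The extension of `η • A` is bounded by `η·sup‖A‖` (`0 ≤ η`). [cite: Balaban1985Averaging, (1) p.17] -/
theorem norm_perCfg_smul_le (A : Bond d (towerP L m k) → 𝔸) {a : ℝ} (hA : ∀ b, η * ‖A b‖ ≤ a) (x : B7Prop1Explicit.Site d) (κ : Fin d) :
    ‖perCfg (towerP L m k) ((η : ℂ) • A) x κ‖ ≤ a := by
  rw [perCfg_apply, Pi.smul_apply, norm_smul, Complex.norm_real, Real.norm_of_nonneg hη]
  exact hA _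

include hL hG hU hα hα3 hα4 h52 hη in
/-- **(135)∕(44) AT A UNIT BOND** («|C_k(U₀, A)| ≦ C₂|A|²», the crews' `B7Eq123General.prop4_general` (i) at `j = k`): `η·sup‖A‖ ≤ a` and [4] Prop. 4's
smallness at `Lᵏa` ⇒ `‖Cblockk A c‖ ≤ C₂·(Lᵏa)²`. [cite: Balaban1985Variational, (44) p.285, (52) p.285; Balaban1985Averaging, (135) p.38, (133) p.38] -/
theorem norm_Cblockk_le (A : Bond d (towerP L m k) → 𝔸) {a : ℝ} (ha : 0 ≤ a) (hA : ∀ b, η * ‖A b‖ ≤ a)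
    (hsmall : Real.exp (4 * (800 * ((d : ℝ) + 1) ^ 2 * ((d : ℝ) + 4)) * α₀) * (1 + 8 * (131072 * ((d : ℝ) + 1) ^ 2) * ((L : ℝ) ^ k * a)) ≤ 2)
    (hc₃ : 2 * ((L : ℝ) ^ k * a) ≤ c3 d L) (c : Bond d m) : ‖Cblockk L m η k U A c‖ ≤ C2T d α₀ * ((L : ℝ) ^ k * a) ^ 2 := by
  have h := (prop4_general L hL hG k _ hU hα hα3 hα4 h52 (perCfg (towerP L m k) ((η : ℂ) • A)) ha
    (norm_perCfg_smul_le L m η k hη A hA) hsmall hc₃ k le_rfl).1 (liftSite c.1) c.2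
  rw [Cblockk_apply, C2T]
  refine h.trans (le_of_eq ?_)
  ring

include hL hG hU hα hα3 hα4 h52 hη in
/-- **[4] PROPOSITION 4's ANALYTICITY CLAUSE AT A UNIT BOND, FRÉCHET IN THE TORUS CONFIGURATION** («Q_k(U₀, ηA, c) … is an analytic function of A»): under
`η·sup‖A‖ ≤ a` and the smallness at `Lᵏa`, `A ↦ Cblockk A c` is analytic at `A` on the finite-dimensional space of torus configurations — `Q_k` by the
crews' `prop4_general_analyticAt` in family form (family `A ↦ perCfg (η•A)`), the linear part by §3 at `QkOfPdev` (a linear map of the configuration).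
[cite: Balaban1985Averaging, Proposition 4 p.38, (127) p.37; Balaban1985Variational, (44) p.285, p.286] -/
theorem analyticAt_Cblockk [FiniteDimensional ℂ 𝔸] (A : Bond d (towerP L m k) → 𝔸) {a : ℝ} (ha : 0 ≤ a) (hA : ∀ b, η * ‖A b‖ ≤ a)
    (hsmall : Real.exp (4 * (800 * ((d : ℝ) + 1) ^ 2 * ((d : ℝ) + 4)) * α₀) * (1 + 8 * (131072 * ((d : ℝ) + 1) ^ 2) * ((L : ℝ) ^ k * a)) ≤ 2)
    (hc₃ : 2 * ((L : ℝ) ^ k * a) ≤ c3 d L) (c : Bond d m) :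
    AnalyticAt ℂ (fun A' : Bond d (towerP L m k) → 𝔸 => Cblockk L m η k U A' c) A := by
  -- the `Q_k` part, in family form
  have hB : ∀ (x : B7Prop1Explicit.Site d) (κ : Fin d),
      AnalyticAt ℂ (fun A' : Bond d (towerP L m k) → 𝔸 => perCfg (towerP L m k) ((η : ℂ) • A') x κ) A := fun x κ => by
    simp only [perCfg_apply, Pi.smul_apply]
    exact (analyticAt_const : AnalyticAt ℂ (fun _ : Bond d (towerP L m k) → 𝔸 => (η : ℂ)) A).smul
      ((ContinuousLinearMap.proj (R := ℂ) (φ := fun _ : Bond d (towerP L m k) => 𝔸) (perSite (towerP L m k) x, κ)).analyticAt A)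
  have hQ := prop4_general_analyticAt L hL hG k _ hU hα hα3 hα4 h52 (fun A' : Bond d (towerP L m k) → 𝔸 => perCfg (towerP L m k) ((η : ℂ) • A'))
    hB ha (norm_perCfg_smul_le L m η k hη A hA) hsmall hc₃ k le_rfl (liftSite c.1) c.2
  -- the linear part: a linear map on a finite-dimensional space (§3 at the canonical data of §2)
  have hlin : AnalyticAt ℂ (fun A' : Bond d (towerP L m k) → 𝔸 => (((L : ℂ) ^ k) * η) • QkOfPdev L m k U hL hG hU hα hα3 hα4 h52 A' c) A :=
    (LinearMap.toContinuousLinearMap ((((L : ℂ) ^ k) * η) • ((LinearMap.proj c).comp (QkOfPdev L m k U hL hG hU hα hα3 hα4 h52)))).analyticAt A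
  have heq : (fun A' : Bond d (towerP L m k) → 𝔸 => Cblockk L m η k U A' c) = fun A' =>
      logCovIter L (perCfg (towerP L m k) U) (perCfg (towerP L m k) ((η : ℂ) • A')) k (liftSite c.1) c.2 -
        (((L : ℂ) ^ k) * η) • QkOfPdev L m k U hL hG hU hα hα3 hα4 h52 A' c := by
    funext A'
    rw [Cblockk_apply, linCovIter_perCfg_smul_k L m η k U (le_trans (by norm_num) hL)]
  rw [heq]
  exact hQ.sub hlin

end Pointwise

end Literature.MathematicalPhysics.QuantumFieldTheory.Balaban1983to89.B11Eq44COperatorTower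

end
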